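import Summits.QuantumFields.BalabanUV.Beta.EriceFlowEnclosureB12AsPrintedHistoryNonuniqueRuns

/-!
# Beta / EriceFlowEnclosureB12AsPrintedHistoryNonuniqueBands — the MULTI-BAND bump family: one bump band per depth scale, so that ONE
# history-dependent β has two distinct bare couplings with the same renormalized coupling at a whole SEQUENCE of (depth, coupling) pairs —
# the letters of the banded family and its runs GIVEN SEPARATION (β-flow team, prover 1 = recursion ∕ upper ∕ bare-coupling ∕ UNIQUENESS side,
# unit `b2b-balaban-beta-bflow-p1`, gen 34; ROW AP-I·C × ROW U; first of three parts (`…Bands` → `…BandsData` → `…BandsSetting`) proving the literal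
# negation of #61e's END `theorem2_existsUnique_of_fadingMemory` at θ = 1, which asks non-uniqueness at ARBITRARILY SMALL renormalized couplings for
# ONE setting; single-band parts: `…HistoryNonunique` (letters), `…HistoryNonuniqueRuns` (runs), `…HistoryNonuniqueEnd` ∕ `…Forward` ∕ `…Setting`)

HONEST FRAMING (page 1 of everything the β sub-cell writes): discharging `BetaPertH` makes Bałaban's UV stability UNCONDITIONAL — a
real constructive-QFT result; it is NOT the continuum limit and NOT the Clay problem.  HONEST DEPENDENCY (cell reorg 2026-08-19,
verbatim): «continuum YM on T⁴ ⇐ BetaPertH ∧ nine spine estimates (0/9 proved); BetaPertH ⇐ (D1) ∧ (D4) ∧ CAP+tail; G-an2-4 gates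
asym, D1 and NE2/3/4.»  THIS MODULE DISCHARGES NOTHING: a TOY FAMILY OF OURS ([folklore]), stated through DEFINING HYPOTHESES (no `def`), against
the cell's HYPOTHESIS SHAPES (`T4CouplingMatching.HistLipschitz ∕ FadingMemory` at θ = 1, `FlowStep.BetaLowerH ∕ BetaUpperH ∕ BetaContH`) — none
printed in [I] = T. Bałaban, Commun. Math. Phys. **109** (1987) [Balaban1987RG1] (p. 298: the dependence on the preceding couplings exists; no modulus;
DELTA-I D-20).  Nothing of Bałaban's β is asserted; no toy is claimed to resemble the construction.

THE BANDED FAMILY.  Band starts n₀ < n₁ < … with 2n_m ≤ n_{m+1} (disjoint bands [n_m, 2n_m)), per-band amplitude ε_m, reference run gᴮ⁽ᵐ⁾,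
normalisation M_m and last-variable factor χ_m:
  β_{j+1}(p) := b + Σ_{m ≤ j} 𝟙[n_m ≤ j < 2n_m]·ε_m·max(1 − |Σ_{i<n_m}(p_i − gᴮ⁽ᵐ⁾_i)|∕M_m, 0)·χ_m(p_j)
— at each scale AT MOST ONE band is active (`band_unique`), so scale-wise the family IS the single-band family of the active band (`bands_eq_single`,
`bands_eq_const`), and every scale-wise letter transfers from `…HistoryNonunique` (§29).  For the runs of band m (§30) one more input is needed:
along run A_m ∕ B_m the EARLIER bands m′ < m (met at scales j < 2n_{m′} ≤ n_m, where the deeper run's couplings are small) must be silent —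
the SEPARATION hypothesis `hsil`, discharged in `…HistoryNonuniqueBandsData` by `bump_zero_of_smallBox` (the deeper run's couplings there are
≤ gᴬ⁽ᵐ′⁾_0∕3); the `Setting` and the END negation are `…HistoryNonuniqueBandsSetting`.

WHAT THIS FILE PROVES (0 sorry, 0 def):
§28 `nb_ge` (n_m ≥ 2^m·n₀ ≥ m + 1), `band_unique` (disjointness), `bands_eq_single` (on band m the family is band m's single family),
    `bands_eq_const` (off all bands β ≡ b).
§29 LETTERS, scale-wise from the single-band ones: `betaLowerH_of_bands`, `betaUpperH_of_bands`, **`histLipschitz_of_bands`** with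
    **`uniformModulus_of_bands`** (`FadingMemory C 1 Λ` as soon as every band has ε_m∕M_m ≤ C and ε_m·L_m ≤ C), `betaContH_of_bands`.
§30 RUNS GIVEN SEPARATION: **`rgEqH_of_bands_runA`**, **`rgEqH_of_bands_runB`** (band m's two runs solve (0.20) for the banded β up to depth 2n_m,
    provided the earlier bands are silent along them).
NOT CLAIMED: anything about Bałaban's β; Theorem 2; `BetaPertH`; continuum; Clay.
-/

namespace Summit.QuantumFields.BalabanUV.Beta.EriceFlowEnclosureB12AsPrintedHistoryNonuniqueBands

open Finset
open Literature.MathematicalPhysics.QuantumFieldTheory.Balaban1983to89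
open Literature.MathematicalPhysics.QuantumFieldTheory.Balaban1983to89.FlowStep (HBeta prefixOf Box mem_box RGEqH BetaLowerH
  BetaUpperH BetaContH)
open Literature.MathematicalPhysics.QuantumFieldTheory.Balaban1983to89.T4CouplingMatching (HistLipschitz FadingMemory)
open Summit.QuantumFields.BalabanUV.Beta.EriceFlowEnclosureB12AsPrintedHistoryNonunique
open Summit.QuantumFields.BalabanUV.Beta.EriceFlowEnclosureB12AsPrintedHistoryNonuniqueRuns

noncomputable section

/-! ## §28 Disjoint bands -/

/-- Band starts grow at least geometrically: n_m ≥ n₀ + m (from 2n_m ≤ n_{m+1} and n₀ ≥ 1), in particular m < n_m. [folklore] -/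
theorem nb_ge {nb : ℕ → ℕ} (h0 : 1 ≤ nb 0) (hsep : ∀ m, 2 * nb m ≤ nb (m + 1)) : ∀ m, nb 0 + m ≤ nb m ∧ m < nb m := by
  intro m
  induction m with
  | zero => exact ⟨le_rfl, h0⟩
  | succ m ih => have := hsep m; constructor <;> omega

/-- Band starts are monotone: n_m ≤ n_{m′} for m ≤ m′. [folklore] -/
theorem nb_mono {nb : ℕ → ℕ} (hsep : ∀ m, 2 * nb m ≤ nb (m + 1)) {m m' : ℕ} (h : m ≤ m') : nb m ≤ nb m' := by
  induction m', h using Nat.le_induction with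
  | base => exact le_rfl
  | succ k _ ih => have := hsep k; omega

/-- **Disjointness**: a scale lies in at most one band. [folklore] -/
theorem band_unique {nb : ℕ → ℕ} (hsep : ∀ m, 2 * nb m ≤ nb (m + 1)) {j m m' : ℕ}
    (hm : nb m ≤ j ∧ j < 2 * nb m) (hm' : nb m' ≤ j ∧ j < 2 * nb m') : m = m' := by
  by_contra hne
  rcases Nat.lt_or_gt_of_ne hne with hlt | hlt
  · have h1 : nb (m + 1) ≤ nb m' := nb_mono hsep (by omega); have h2 := hsep m; omega
  · have h1 : nb (m' + 1) ≤ nb m := nb_mono hsep (by omega); have h2 := hsep m'; omega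

/-- **On band m the banded family IS band m's single-band family**: every other summand vanishes at that scale. [folklore] -/
theorem bands_eq_single {β : HBeta} {b : ℝ} {nb : ℕ → ℕ} {εb Mb : ℕ → ℝ} {gBb : ℕ → ℕ → ℝ} {χb : ℕ → ℝ → ℝ}
    (hβ : ∀ (j : ℕ) (p : Fin (j + 1) → ℝ), β j p = b + ∑ m ∈ range (j + 1), (if nb m ≤ j ∧ j < 2 * nb m then
      εb m * max (1 - |∑ i : Fin (j + 1), (if (i : ℕ) < nb m then p i - gBb m i else 0)| / Mb m) 0 * χb m (p (Fin.last j)) else 0))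
    (h0 : 1 ≤ nb 0) (hsep : ∀ m, 2 * nb m ≤ nb (m + 1)) {m j : ℕ} (hj : nb m ≤ j ∧ j < 2 * nb m) (p : Fin (j + 1) → ℝ) :
    β j p = b + (if nb m ≤ j ∧ j < 2 * nb m then
      εb m * max (1 - |∑ i : Fin (j + 1), (if (i : ℕ) < nb m then p i - gBb m i else 0)| / Mb m) 0 * χb m (p (Fin.last j)) else 0) := by
  rw [hβ j p]
  congr 1
  have hmj : m ∈ range (j + 1) := by have := (nb_ge h0 hsep m).2; exact mem_range.mpr (by omega)
  rw [Finset.sum_eq_single_of_mem m hmj]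
  intro m' _ hm'
  rw [if_neg]
  exact fun h => hm' (band_unique hsep h hj)

/-- **Off all bands the family is the constant b.** [folklore] -/
theorem bands_eq_const {β : HBeta} {b : ℝ} {nb : ℕ → ℕ} {εb Mb : ℕ → ℝ} {gBb : ℕ → ℕ → ℝ} {χb : ℕ → ℝ → ℝ}
    (hβ : ∀ (j : ℕ) (p : Fin (j + 1) → ℝ), β j p = b + ∑ m ∈ range (j + 1), (if nb m ≤ j ∧ j < 2 * nb m then
      εb m * max (1 - |∑ i : Fin (j + 1), (if (i : ℕ) < nb m then p i - gBb m i else 0)| / Mb m) 0 * χb m (p (Fin.last j)) else 0))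
    {j : ℕ} (hj : ∀ m, ¬(nb m ≤ j ∧ j < 2 * nb m)) (p : Fin (j + 1) → ℝ) : β j p = b := by
  rw [hβ j p, Finset.sum_eq_zero (fun m _ => if_neg (hj m)), add_zero]

/-- Scale-wise dictionary: at EVERY scale j the banded family agrees with band m's single-band family of `…HistoryNonunique` for some m with
every OTHER band silent at j (band m itself may be silent too: off all bands, m = 0 and both sides are the constant b). [folklore] -/
theorem bands_scalewise {β : HBeta} {b : ℝ} {nb : ℕ → ℕ} {εb Mb : ℕ → ℝ} {gBb : ℕ → ℕ → ℝ} {χb : ℕ → ℝ → ℝ}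
    (hβ : ∀ (j : ℕ) (p : Fin (j + 1) → ℝ), β j p = b + ∑ m ∈ range (j + 1), (if nb m ≤ j ∧ j < 2 * nb m then
      εb m * max (1 - |∑ i : Fin (j + 1), (if (i : ℕ) < nb m then p i - gBb m i else 0)| / Mb m) 0 * χb m (p (Fin.last j)) else 0))
    (h0 : 1 ≤ nb 0) (hsep : ∀ m, 2 * nb m ≤ nb (m + 1)) (j : ℕ) :
    ∃ m, (∀ m', m' ≠ m → ¬(nb m' ≤ j ∧ j < 2 * nb m')) ∧ ∀ p : Fin (j + 1) → ℝ, β j p = b + (if nb m ≤ j ∧ j < 2 * nb m then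
      εb m * max (1 - |∑ i : Fin (j + 1), (if (i : ℕ) < nb m then p i - gBb m i else 0)| / Mb m) 0 * χb m (p (Fin.last j)) else 0) := by
  by_cases h : ∃ m, nb m ≤ j ∧ j < 2 * nb m
  · obtain ⟨m, hm⟩ := h
    exact ⟨m, fun m' hm' h' => hm' (band_unique hsep h' hm), fun p => bands_eq_single hβ h0 hsep hm p⟩
  · refine ⟨0, fun m' _ hm' => h ⟨m', hm'⟩, fun p => ?_⟩
    rw [bands_eq_const hβ (fun m hm => h ⟨m, hm⟩) p, if_neg (fun hm => h ⟨0, hm⟩), add_zero]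

/-! ## §29 The letters of the banded family, scale-wise from the single-band ones -/

/-- **AF lower letter** for the banded family (every ε_m ≥ 0, M_m ≥ 0, 0 ≤ χ_m ≤ 1). [folklore] -/
theorem betaLowerH_of_bands {β : HBeta} {b : ℝ} {nb : ℕ → ℕ} {εb Mb : ℕ → ℝ} {gBb : ℕ → ℕ → ℝ} {χb : ℕ → ℝ → ℝ}
    (hβ : ∀ (j : ℕ) (p : Fin (j + 1) → ℝ), β j p = b + ∑ m ∈ range (j + 1), (if nb m ≤ j ∧ j < 2 * nb m then
      εb m * max (1 - |∑ i : Fin (j + 1), (if (i : ℕ) < nb m then p i - gBb m i else 0)| / Mb m) 0 * χb m (p (Fin.last j)) else 0))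
    (h0 : 1 ≤ nb 0) (hsep : ∀ m, 2 * nb m ≤ nb (m + 1)) (hε : ∀ m, 0 ≤ εb m) (hM : ∀ m, 0 ≤ Mb m)
    (hχ : ∀ m s, 0 ≤ χb m s ∧ χb m s ≤ 1) (γ : ℝ) : BetaLowerH b γ β := by
  intro k v hv
  obtain ⟨m, -, hm⟩ := bands_scalewise hβ h0 hsep k
  have h := betaLowerH_of_bumpFamily (b := b) (ε := εb m) (M := Mb m) (n := nb m) (gB := gBb m) (χ := χb m)
    (β := fun j p => b + (if nb m ≤ j ∧ j < 2 * nb m then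
      εb m * max (1 - |∑ i : Fin (j + 1), (if (i : ℕ) < nb m then p i - gBb m i else 0)| / Mb m) 0 * χb m (p (Fin.last j)) else 0))
    (fun _ _ => rfl) (hε m) (hM m) (hχ m) γ k v hv
  rw [hm v]; exact h

/-- **Upper letter** `β ≤ b + a` for the banded family when every amplitude ε_m ≤ a. [folklore] -/
theorem betaUpperH_of_bands {β : HBeta} {b a : ℝ} {nb : ℕ → ℕ} {εb Mb : ℕ → ℝ} {gBb : ℕ → ℕ → ℝ} {χb : ℕ → ℝ → ℝ}
    (hβ : ∀ (j : ℕ) (p : Fin (j + 1) → ℝ), β j p = b + ∑ m ∈ range (j + 1), (if nb m ≤ j ∧ j < 2 * nb m then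
      εb m * max (1 - |∑ i : Fin (j + 1), (if (i : ℕ) < nb m then p i - gBb m i else 0)| / Mb m) 0 * χb m (p (Fin.last j)) else 0))
    (h0 : 1 ≤ nb 0) (hsep : ∀ m, 2 * nb m ≤ nb (m + 1)) (hε : ∀ m, 0 ≤ εb m) (hεa : ∀ m, εb m ≤ a) (hM : ∀ m, 0 ≤ Mb m)
    (hχ : ∀ m s, 0 ≤ χb m s ∧ χb m s ≤ 1) (γ : ℝ) : BetaUpperH (b + a) γ β := by
  intro k v hv
  obtain ⟨m, -, hm⟩ := bands_scalewise hβ h0 hsep k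
  have h := betaUpperH_of_bumpFamily (b := b) (ε := εb m) (M := Mb m) (n := nb m) (gB := gBb m) (χ := χb m)
    (β := fun j p => b + (if nb m ≤ j ∧ j < 2 * nb m then
      εb m * max (1 - |∑ i : Fin (j + 1), (if (i : ℕ) < nb m then p i - gBb m i else 0)| / Mb m) 0 * χb m (p (Fin.last j)) else 0))
    (fun _ _ => rfl) (hε m) (hM m) (hχ m) γ k v hv
  rw [hm v]; exact h.trans (by linarith [hεa m])

/-- **(C) holds** for the banded family (every χ_m continuous). [folklore] -/
theorem betaContH_of_bands {β : HBeta} {b : ℝ} {nb : ℕ → ℕ} {εb Mb : ℕ → ℝ} {gBb : ℕ → ℕ → ℝ} {χb : ℕ → ℝ → ℝ}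
    (hβ : ∀ (j : ℕ) (p : Fin (j + 1) → ℝ), β j p = b + ∑ m ∈ range (j + 1), (if nb m ≤ j ∧ j < 2 * nb m then
      εb m * max (1 - |∑ i : Fin (j + 1), (if (i : ℕ) < nb m then p i - gBb m i else 0)| / Mb m) 0 * χb m (p (Fin.last j)) else 0))
    (h0 : 1 ≤ nb 0) (hsep : ∀ m, 2 * nb m ≤ nb (m + 1)) (hχc : ∀ m, Continuous (χb m)) (γ : ℝ) : BetaContH γ β := by
  intro k
  obtain ⟨m, -, hm⟩ := bands_scalewise hβ h0 hsep k
  have h := betaContH_of_bumpFamily (b := b) (ε := εb m) (M := Mb m) (n := nb m) (gB := gBb m) (χ := χb m)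
    (β := fun j p => b + (if nb m ≤ j ∧ j < 2 * nb m then
      εb m * max (1 - |∑ i : Fin (j + 1), (if (i : ℕ) < nb m then p i - gBb m i else 0)| / Mb m) 0 * χb m (p (Fin.last j)) else 0))
    (fun _ _ => rfl) (hχc m) γ k
  have hfun : β k = fun p => b + (if nb m ≤ k ∧ k < 2 * nb m then
      εb m * max (1 - |∑ i : Fin (k + 1), (if (i : ℕ) < nb m then p i - gBb m i else 0)| / Mb m) 0 * χb m (p (Fin.last k)) else 0) :=
    funext hm
  rw [hfun]; exact h

/-- **THE HISTORY MODULI OF THE BANDED FAMILY**: `HistLipschitz Λ γ β` with Λ j i = Σ_m (band m's modulus at scale j) — at most one summand is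
nonzero: ε_m∕M_m for the n_m oldest couplings and ε_m·L_m for the last one on band m, zero off all bands. [folklore] -/
theorem histLipschitz_of_bands {β : HBeta} {b : ℝ} {nb : ℕ → ℕ} {εb Mb Lb : ℕ → ℝ} {gBb : ℕ → ℕ → ℝ} {χb : ℕ → ℝ → ℝ}
    (hβ : ∀ (j : ℕ) (p : Fin (j + 1) → ℝ), β j p = b + ∑ m ∈ range (j + 1), (if nb m ≤ j ∧ j < 2 * nb m then
      εb m * max (1 - |∑ i : Fin (j + 1), (if (i : ℕ) < nb m then p i - gBb m i else 0)| / Mb m) 0 * χb m (p (Fin.last j)) else 0))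
    (h0 : 1 ≤ nb 0) (hsep : ∀ m, 2 * nb m ≤ nb (m + 1)) (hε : ∀ m, 0 ≤ εb m) (hM : ∀ m, 0 < Mb m)
    (hχ : ∀ m s, 0 ≤ χb m s ∧ χb m s ≤ 1) {γ : ℝ}
    (hχL : ∀ m s t, s ∈ Set.Icc (0 : ℝ) γ → t ∈ Set.Icc (0 : ℝ) γ → |χb m s - χb m t| ≤ Lb m * |s - t|) :
    HistLipschitz (fun j i => ∑ m ∈ range (j + 1), (if nb m ≤ j ∧ j < 2 * nb m then
      (if i < nb m then εb m / Mb m else 0) + (if i = j then εb m * Lb m else 0) else 0)) γ β := by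
  intro k p q hp hq
  obtain ⟨m, hsil, hm⟩ := bands_scalewise hβ h0 hsep k
  have h := histLipschitz_of_bumpFamily (b := b) (ε := εb m) (M := Mb m) (n := nb m) (gB := gBb m) (χ := χb m) (Lχ := Lb m)
    (β := fun j p => b + (if nb m ≤ j ∧ j < 2 * nb m then
      εb m * max (1 - |∑ i : Fin (j + 1), (if (i : ℕ) < nb m then p i - gBb m i else 0)| / Mb m) 0 * χb m (p (Fin.last j)) else 0))
    (fun _ _ => rfl) (hε m) (hM m) (hχ m) (hχL m) k p q hp hq
  have hΛ : ∀ i : Fin (k + 1), (∑ m' ∈ range (k + 1), (if nb m' ≤ k ∧ k < 2 * nb m' then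
      (if (i : ℕ) < nb m' then εb m' / Mb m' else 0) + (if (i : ℕ) = k then εb m' * Lb m' else 0) else 0))
      = (if nb m ≤ k ∧ k < 2 * nb m then
          (if (i : ℕ) < nb m then εb m / Mb m else 0) + (if (i : ℕ) = k then εb m * Lb m else 0) else 0) := by
    intro i
    by_cases hk : nb m ≤ k ∧ k < 2 * nb m
    · have hmk : m ∈ range (k + 1) := by have := (nb_ge h0 hsep m).2; exact mem_range.mpr (by omega)
      rw [Finset.sum_eq_single_of_mem m hmk (fun m' _ hm' => if_neg (hsil m' hm'))]
    · rw [if_neg hk]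
      exact Finset.sum_eq_zero fun m' _ => by
        by_cases hmm : m' = m
        · subst hmm; exact if_neg hk
        · exact if_neg (hsil m' hmm)
  rw [hm p, hm q]
  refine h.trans (le_of_eq (Finset.sum_congr rfl fun i _ => ?_))
  beta_reduce
  rw [hΛ i]

/-- **… AND THEY ARE UNIFORM: `FadingMemory C 1 Λ`** for the banded moduli as soon as EVERY band has ε_m∕M_m ≤ C and ε_m·L_m ≤ C (one constant C for
all bands and all ages). [folklore] -/
theorem uniformModulus_of_bands {nb : ℕ → ℕ} {εb Mb Lb : ℕ → ℝ} {C : ℝ} (h0 : 1 ≤ nb 0) (hsep : ∀ m, 2 * nb m ≤ nb (m + 1))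
    (hε : ∀ m, 0 ≤ εb m) (hM : ∀ m, 0 < Mb m) (hL : ∀ m, 0 ≤ Lb m) (hC1 : ∀ m, εb m / Mb m ≤ C) (hC2 : ∀ m, εb m * Lb m ≤ C) :
    FadingMemory C 1 (fun j i => ∑ m ∈ range (j + 1), (if nb m ≤ j ∧ j < 2 * nb m then
      (if i < nb m then εb m / Mb m else 0) + (if i = j then εb m * Lb m else 0) else 0)) := by
  intro k i hik
  have hC : 0 ≤ C := (div_nonneg (hε 0) (hM 0).le).trans (hC1 0)
  have hterm : ∀ m, 0 ≤ (if nb m ≤ k ∧ k < 2 * nb m then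
      (if i < nb m then εb m / Mb m else 0) + (if i = k then εb m * Lb m else 0) else 0) ∧
      (if nb m ≤ k ∧ k < 2 * nb m then
      (if i < nb m then εb m / Mb m else 0) + (if i = k then εb m * Lb m else 0) else 0) ≤ C * 1 ^ (k - i) := by
    intro m
    have := uniformModulus_of_bumpFamily (n := nb m) (hε m) (hM m) (hL m) (hC1 m) (hC2 m) k i hik
    exact this
  by_cases hex : ∃ m, nb m ≤ k ∧ k < 2 * nb m
  · obtain ⟨m, hm⟩ := hex
    have hmk : m ∈ range (k + 1) := by have := (nb_ge h0 hsep m).2; exact mem_range.mpr (by omega)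
    simp only
    rw [Finset.sum_eq_single_of_mem m hmk (fun m' _ hm' => if_neg (fun h' => hm' (band_unique hsep h' hm)))]
    exact hterm m
  · simp only
    rw [Finset.sum_eq_zero (fun m' _ => if_neg (fun h' => hex ⟨m', h'⟩))]
    exact ⟨le_rfl, by rw [one_pow, mul_one]; exact hC⟩

/-! ## §30 The runs of band m, given separation -/

/-- **RUN A OF BAND m SOLVES (0.20) FOR THE BANDED β** up to depth 2n_m, provided every EARLIER band m′ < m is SILENT along it (`hsil`: at the
scales j of band m′ the bump of band m′ vanishes at run A's prefix — the separation the data module supplies by `bump_zero_of_smallBox`). [cite: Balaban1987RG1, (0.20) p.256 with p.298] -/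
theorem rgEqH_of_bands_runA {β : HBeta} {b x₀ : ℝ} {nb : ℕ → ℕ} {εb Mb : ℕ → ℝ} {gBb : ℕ → ℕ → ℝ} {χb : ℕ → ℝ → ℝ} {gA : ℕ → ℝ}
    (hβ : ∀ (j : ℕ) (p : Fin (j + 1) → ℝ), β j p = b + ∑ m ∈ range (j + 1), (if nb m ≤ j ∧ j < 2 * nb m then
      εb m * max (1 - |∑ i : Fin (j + 1), (if (i : ℕ) < nb m then p i - gBb m i else 0)| / Mb m) 0 * χb m (p (Fin.last j)) else 0))
    (h0 : 1 ≤ nb 0) (hsep : ∀ m, 2 * nb m ≤ nb (m + 1)) {m : ℕ} (hb : 0 ≤ b)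
    (hA : ∀ i, gA i = 1 / Real.sqrt (x₀ - b * i)) (hx : b * (2 * nb m) < x₀)
    (hMm : Mb m = ∑ i ∈ range (nb m), (gA i - gBb m i)) (hMpos : 0 < Mb m)
    (hsil : ∀ m', m' < m → ∀ j, nb m' ≤ j → j < 2 * nb m' →
      max (1 - |∑ i : Fin (j + 1), (if (i : ℕ) < nb m' then prefixOf gA j i - gBb m' i else 0)| / Mb m') 0 = 0) :
    RGEqH (2 * nb m) β gA := by
  -- band m's single family and its run A
  have hone := rgEqH_runA (b := b) (ε := εb m) (M := Mb m) (n := nb m) (gB := gBb m) (χ := χb m)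
    (β := fun j p => b + (if nb m ≤ j ∧ j < 2 * nb m then
      εb m * max (1 - |∑ i : Fin (j + 1), (if (i : ℕ) < nb m then p i - gBb m i else 0)| / Mb m) 0 * χb m (p (Fin.last j)) else 0))
    (fun _ _ => rfl) hA hb hx hMm hMpos
  intro j hj
  have e := hone j hj
  -- at scale j the banded β at run A's prefix equals band m's single family at that prefix
  suffices hid : β j (prefixOf gA j) = b + (if nb m ≤ j ∧ j < 2 * nb m then
      εb m * max (1 - |∑ i : Fin (j + 1), (if (i : ℕ) < nb m then prefixOf gA j i - gBb m i else 0)| / Mb m) 0 *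
        χb m (prefixOf gA j (Fin.last j)) else 0) by rw [hid]; exact e
  obtain ⟨m₁, hsil₁, hm₁⟩ := bands_scalewise hβ h0 hsep j
  rw [hm₁]
  by_cases hjm : nb m ≤ j ∧ j < 2 * nb m
  · -- j in band m: then m₁ = m (every other band is silent at j, and band m is not)
    have : m₁ = m := by by_contra hne; exact hsil₁ m (Ne.symm hne) hjm
    subst this; rfl
  · rw [if_neg hjm]
    by_cases hjm₁ : nb m₁ ≤ j ∧ j < 2 * nb m₁
    · -- j in an EARLIER band m₁ < m (j < 2 n_m ≤ n_{m'} for m' > m): silent along run A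
      have hlt : m₁ < m := by
        by_contra hge
        rcases Nat.lt_or_eq_of_le (Nat.le_of_not_lt hge) with hgt | heq
        · have h1 : nb (m + 1) ≤ nb m₁ := nb_mono hsep (by omega); have h2 := hsep m; omega
        · exact hjm (heq ▸ hjm₁)
      rw [if_pos hjm₁, hsil m₁ hlt j hjm₁.1 hjm₁.2, mul_zero, zero_mul, add_zero]
    · rw [if_neg hjm₁]

/-- **RUN B OF BAND m SOLVES (0.20) FOR THE BANDED β** up to depth 2n_m, provided χ_m = 1 at its band couplings and every earlier band is silent
along it. [cite: Balaban1987RG1, (0.20) p.256 with p.298] -/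
theorem rgEqH_of_bands_runB {β : HBeta} {b x₀ : ℝ} {nb : ℕ → ℕ} {εb Mb : ℕ → ℝ} {gBb : ℕ → ℕ → ℝ} {χb : ℕ → ℝ → ℝ}
    (hβ : ∀ (j : ℕ) (p : Fin (j + 1) → ℝ), β j p = b + ∑ m ∈ range (j + 1), (if nb m ≤ j ∧ j < 2 * nb m then
      εb m * max (1 - |∑ i : Fin (j + 1), (if (i : ℕ) < nb m then p i - gBb m i else 0)| / Mb m) 0 * χb m (p (Fin.last j)) else 0))
    (h0 : 1 ≤ nb 0) (hsep : ∀ m, 2 * nb m ≤ nb (m + 1)) {m : ℕ} (hb : 0 ≤ b) (hε : 0 ≤ εb m)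
    (hB : ∀ i, gBb m i = 1 / Real.sqrt (x₀ - b * i + εb m * ((nb m - (i - nb m) : ℕ) : ℝ))) (hx : b * (2 * nb m) < x₀)
    (hχB : ∀ j, nb m ≤ j → j < 2 * nb m → χb m (gBb m j) = 1)
    (hsil : ∀ m', m' < m → ∀ j, nb m' ≤ j → j < 2 * nb m' →
      max (1 - |∑ i : Fin (j + 1), (if (i : ℕ) < nb m' then prefixOf (gBb m) j i - gBb m' i else 0)| / Mb m') 0 = 0) :
    RGEqH (2 * nb m) β (gBb m) := by
  have hone := rgEqH_runB (b := b) (ε := εb m) (M := Mb m) (n := nb m) (gB := gBb m) (χ := χb m)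
    (β := fun j p => b + (if nb m ≤ j ∧ j < 2 * nb m then
      εb m * max (1 - |∑ i : Fin (j + 1), (if (i : ℕ) < nb m then p i - gBb m i else 0)| / Mb m) 0 * χb m (p (Fin.last j)) else 0))
    (fun _ _ => rfl) hB hb hε hx hχB
  intro j hj
  have e := hone j hj
  suffices hid : β j (prefixOf (gBb m) j) = b + (if nb m ≤ j ∧ j < 2 * nb m then
      εb m * max (1 - |∑ i : Fin (j + 1), (if (i : ℕ) < nb m then prefixOf (gBb m) j i - gBb m i else 0)| / Mb m) 0 *
        χb m (prefixOf (gBb m) j (Fin.last j)) else 0) by rw [hid]; exact e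
  obtain ⟨m₁, hsil₁, hm₁⟩ := bands_scalewise hβ h0 hsep j
  rw [hm₁]
  by_cases hjm : nb m ≤ j ∧ j < 2 * nb m
  · have : m₁ = m := by by_contra hne; exact hsil₁ m (Ne.symm hne) hjm
    subst this; rfl
  · rw [if_neg hjm]
    by_cases hjm₁ : nb m₁ ≤ j ∧ j < 2 * nb m₁
    · have hlt : m₁ < m := by
        by_contra hge
        rcases Nat.lt_or_eq_of_le (Nat.le_of_not_lt hge) with hgt | heq
        · have h1 : nb (m + 1) ≤ nb m₁ := nb_mono hsep (by omega); have h2 := hsep m; omega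
        · exact hjm (heq ▸ hjm₁)
      rw [if_pos hjm₁, hsil m₁ hlt j hjm₁.1 hjm₁.2, mul_zero, zero_mul, add_zero]
    · rw [if_neg hjm₁]

end

end Summit.QuantumFields.BalabanUV.Beta.EriceFlowEnclosureB12AsPrintedHistoryNonuniqueBands
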